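import Summits.QuantumFields.YangMills.Theorems.BalabanUVNodesN12IteratedPlaqLetterOfFamilyLam
import Summits.QuantumFields.YangMills.Theorems.BalabanUVNodesN12SegmentPlaqFamilyAtRecord
import HarnessLib

/-!
# BalabanUVNodes ∕ N12 — THE (σ)_N CAPSTONE MODULO CLASS, DATUM, REGION GEOMETRY AND NUMERICS, AT PRINT's DATUM `Λ(Z) = lamBondsSeq (maxDomT ν.M₁ Z) k` ([Balaban1984PropagatorsII] (2.3)):
# dag-n12-w3's `…N12SegmentPlaqFamilyAtRecord.exists_gaugeLetterLoc_atRecord_of_class_geometry` RE-KEYED — the segment plaquette family of the (b)-members (the parent's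
# `exists_segmentPlaqFamily_Bj`, datum geometry only) RESTRICTED to print members (`Λ_i(Z) ⊆ bondsOf Γ_i^{(i)}`) feeds O1 (7) — O1 module (8) of the gauge-letter chain (dag-n12-d CEDE ∕ dag-lead
# WORDS 426∕427∕430, pub-ymgap INBOX 2026-08-30)

[Balaban1984PropagatorsII] = «[II]», (2.3) p. 224; [Balaban1985Averaging], Prop. 2 (52)–(53) p. 26; [Balaban1985Variational] = «[15]», (2)–(4) p. 278, (16)–(18) p. 280; [Balaban1985RegularSpaces] =
«[6]», (1.7) p. 77, (1.19) p. 79; [Balaban1988Convergent] = «[III]», p. 255, (2.12)–(2.13) pp. 256–257, (2.16) p. 257, p. 267; [Balaban1987RG1] = «[RG1]», (0.1)–(0.3) pp. 251–252.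

Cell `pub-ymgap` (HUMAN RULINGS D-0062 ∕ D-0149), lane `pub-ymgap-dag-n12-c` g37 (R134 seat (a), N12 = [B15], s1, lane owner); `--kind proof --supports` K1⁹ `stmt-QuantumFields-27364` `--as helper`;
count-neutral.  THEOREMS ONLY (0 `def`, 0 `instance`, 0 `sorry`); the parent's capstone statement (tree bytes, `work/gen_segment_lam.py`) with `hmin ↦ IsMinimizerB … (lamBondsSeq …)`, `hGmem`∕`hu`
on print members, Cin on all of `N`; proof: the parent's `exists_segmentPlaqFamily_Bj` (datum-free geometry of the (b)-members, REUSED) restricted along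
`B15DeterminingSetsB.lamBondsSeq_subset_bondsOf_genSet`, then O1 (7) `…N12IteratedPlaqLetterOfFamilyLam.exists_gaugeLetterLoc_atRecord_lamBondsSeq_of_class_of_family`.  DECL MAP (old → new):
`N12SegmentPlaqFamilyAtRecord.exists_gaugeLetterLoc_atRecord_of_class_geometry ↦ N12SegmentPlaqFamilyAtRecordLam.exists_gaugeLetterLoc_atRecord_lamBondsSeq_of_class_geometry`; the parent's
`embIter_mem_maxDomT_of_mem_Bj` ∕ `exists_anchor_of_mem_bondsOf` ∕ `base_subset_topSeq` ∕ `exists_segmentPlaqFamily_Bj` unchanged (site∕(b)-member geometry, valid a fortiori for print members).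

HONEST FRAMING.  Composition by name; the minimiser ([15] Thm 1 ∕ (E)), the region datum, the `N`-geometry, the shadow geometry, the budgets and the numerics stay HYPOTHESES; nothing of
Bałaban's asserted or refuted beyond the cited tree theorems; count-neutral helper (`--supports 27364`); N12 NOT discharged; K0⁷∕K1⁹ NOT closed; counts of record unmoved (typed 28∕28 ·
discharged 8∕27); one finite 𝕋⁴ programme at fixed ε — R4 closes the conditional rung `BalabanLadder.UV` only; the Yang–Mills mass gap (Clay) is NOT proved by any of this; nothing continuum ∕
ℝ⁴ ∕ OS.
-/

noncomputable section

open scoped Matrix.Norms.L2Operator BigOperators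

namespace Summit.QuantumFields.YangMills.BalabanUVNodes.N12SegmentPlaqFamilyAtRecordLam

open Literature.MathematicalPhysics.QuantumFieldTheory.Balaban1983to89
open T4Continuum GaugeField B15DeterminingSets B15DeterminingSetsB BlockAveraging
open T4CubeChartGnomonic (SU2)
open B16Sect1Backgrounds (toMS)
open B14.Eq213MaximalDomains (side)
open B14.Eq213DetSet (Bj maxDomT)
open B14.Eq22Determines (blockIter)
open B5Eq118OneStroke (iterBlockOf)
open B8Eq17ClassAkV1 (plaqsOf)
open ExpMeanLog (deltaSU)
open Literature.MathematicalPhysics.QuantumFieldTheory.BalabanImbrieJaffe1984to88.BIJ85Eq453GaugeField (qsstarGIter0)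
open Summit.QuantumFields.YangMills.BalabanUVNodes.N20LCSAvgDominationRegion (boxRegion)
open Summit.QuantumFields.YangMills.BalabanUVNodes.N12SegmentPlaqFamilyAtRecord (exists_segmentPlaqFamily_Bj)
open Summit.QuantumFields.YangMills.BalabanUVNodes.N12IteratedPlaqLetterOfFamilyLam (exists_gaugeLetterLoc_atRecord_lamBondsSeq_of_class_of_family)

/-! ## The (σ)_N capstone at print's datum modulo class, datum, region geometry and numerics -/

/-- ★★★ **[PRINT's DATUM `Λ(Z)`: `hmin ↦ IsMinimizerB … (lamBondsSeq …)`, `hGmem`∕`hu` on print members, Cin on all of `N`; the segment family of the (b)-members restricted to print members.]** **(σ)_N AT THE RECORD MODULO CLASS, DATUM, REGION GEOMETRY AND NUMERICS.**  `N12IteratedPlaqLetterOfFamilyLam.exists_gaugeLetterLoc_atRecord_lamBondsSeq_of_class_of_family` with the family supplied by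
the parent's `exists_segmentPlaqFamily_Bj` (restricted to print members).  RESIDUE: the minimiser in NODE 00's class (`hmin`), the region datum `W 𝒞 ρn` (`hD`), the region's geometry letters `hGN` ∕ `hN1` (dag-n12-w6's) and `hGmem` (member
shadows in `𝒞`), the tower budgets `θ`, and NUMERICS: `εreg` positive and small, no wrapping `hN`, radii `hRad`, `M₁ ≥ ((d+4)L+6)·L²`, `2 ≤ M₁`, cover divisibility.  Every plaquette estimate is read
off [15] (2) ∕ [6] (1.7) (the class) and [Balaban1985Averaging] Prop. 2 (dag-n11, local) by name.
[cite: Balaban1985Variational, (2)–(4) p.278, (16)–(18) p.280; Balaban1985RegularSpaces, (1.7) p.77, (1.19) p.79; Balaban1985Averaging, Prop. 2 (52)–(53) p.26; Balaban1988Convergent, (2.12)–(2.13) pp.256–257, (2.16) p.257, p.267] -/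
theorem exists_gaugeLetterLoc_atRecord_lamBondsSeq_of_class_geometry {F : T4Family} (ν : Node00.Stage7Numerics) (Kt : ℕ) {k : ℕ} (hk0 : 0 < k) (hk : k ≤ (F.P Kt).m + (F.P Kt).K)
    (hM2 : 2 ≤ ν.M₁) (hdiv : side (F.P Kt).L ν.M₁ k ∣ (F.P Kt).sitesPerDir 0) (Z : Set (Site (F.P Kt) 0))
    -- no wrapping, at the caps `ℓ_k`, `m·L^k`
    (hN : 2 * (∑ i ∈ Finset.range (k + 1), ((F.P Kt).d * (((F.P Kt).L ^ i - 1) / 2) + 1)) + 1 +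
      (3 * ((F.P Kt).d * (((F.P Kt).L - 1) / 2)) + 5) * (F.P Kt).L ^ k < (F.P Kt).sitesPerDir 0)
    -- radius numerics: the level-`J` box fits the collar `L^{J−1}·M₁`
    (hRad : ∀ J, 1 ≤ J → J ≤ k →
      (2 * ∑ i ∈ Finset.range (J + 1 + 1), ((F.P Kt).d * (((F.P Kt).L ^ i - 1) / 2) + 1)) + 1 +
          (3 * ((F.P Kt).d * (((F.P Kt).L - 1) / 2)) + 5) * (F.P Kt).L ^ min (J + 1) k +
        (∑ i ∈ Finset.range (J + 1), ((F.P Kt).d * (((F.P Kt).L ^ i - 1) / 2) + 1)) + 3 ≤ (F.P Kt).L ^ (J - 1) * ν.M₁)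
    -- the region-normalised datum and the minimiser
    {ρn : ℝ} (hρn : 0 ≤ ρn)
    (W : GaugeField (F.P Kt) k SU2) (𝒞 : Set (PBond (F.P Kt) k)) (hD : ∀ c ∈ 𝒞, dist1 (W c) ≤ ρn)
    {U₀ : GaugeField (F.P Kt) 0 SU2}
    (hmin : IsMinimizerB (Node00.avOfRecord F 2 Kt) (Node00.regMSCoPOfRecord F 2 ν Kt k (maxDomT ν.M₁ Z)) (lamBondsSeq (maxDomT ν.M₁ Z) k)
      (avgFamily (Node00.avOfRecord F 2 Kt) (qsstarGIter0 k W)) U₀)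
    -- geometry of the neighbourhood (dag-n12-w6's letters, verbatim)
    (N : Set (PBond (F.P Kt) 0))
    (hGN : ∀ b ∈ N, (b.src ∉ maxDomT ν.M₁ Z 1 ∨ b.tgt ∉ maxDomT ν.M₁ Z 1) → blockIter k b.tgt ≠ blockIter k b.src →
      (⟨blockIter k b.src, b.dir⟩ : PBond (F.P Kt) k) ∈ 𝒞)
    (hN1 : ∀ p : Plaq (F.P Kt) 0, ((⟨p.src, p.μ⟩ : PBond (F.P Kt) 0) ∈ {b : PBond (F.P Kt) 0 | b.src ∈ maxDomT ν.M₁ Z 1} ∨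
        (⟨p.src.shift p.μ, p.ν⟩ : PBond (F.P Kt) 0) ∈ {b : PBond (F.P Kt) 0 | b.src ∈ maxDomT ν.M₁ Z 1} ∨
        (⟨p.src.shift p.ν, p.μ⟩ : PBond (F.P Kt) 0) ∈ {b : PBond (F.P Kt) 0 | b.src ∈ maxDomT ν.M₁ Z 1} ∨
        (⟨p.src, p.ν⟩ : PBond (F.P Kt) 0) ∈ {b : PBond (F.P Kt) 0 | b.src ∈ maxDomT ν.M₁ Z 1}) →
      (⟨p.src, p.μ⟩ : PBond (F.P Kt) 0) ∈ N ∧ (⟨p.src.shift p.μ, p.ν⟩ : PBond (F.P Kt) 0) ∈ N ∧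
        (⟨p.src.shift p.ν, p.μ⟩ : PBond (F.P Kt) 0) ∈ N ∧ (⟨p.src, p.ν⟩ : PBond (F.P Kt) 0) ∈ N)
    -- the class threshold `εreg`: positive and small ([Balaban1985Averaging] Prop. 2's smallness at `α₀ := εreg·L²`)
    (hεpos : 0 < ν.εreg)
    (hα3 : (143 * (((((F.P Kt).d + 4 : ℕ) : ℝ)) ^ 2 / 4) ^ 2) * (ν.εreg * (F.P Kt).L ^ 2) ≤ 1 / 3)
    (hα2 : 2 * (ν.εreg * (F.P Kt).L ^ 2) ≤ 2 * deltaSU (Fin 2) / ((((F.P Kt).d + 4) * (F.P Kt).L : ℕ) : ℝ) ^ 2)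
    (haN : (((((F.P Kt).d + 2) * (F.P Kt).L : ℕ) : ℝ) ^ 2 / 4) * (2 * (ν.εreg * (F.P Kt).L ^ 2)) < deltaSU (Fin 2))
    -- the tower budgets `θ` fed by the constant plaquette bound `a := 2·εreg·L²`
    (θ : ℕ → ℝ) (hθ0 : 0 ≤ θ 0)
    (hθ : ∀ j, 6 * ((((((F.P Kt).d + 2) * (F.P Kt).L : ℕ) : ℝ) ^ 2 / 4) * (2 * (ν.εreg * (F.P Kt).L ^ 2))) + (F.P Kt).L * θ j ≤ θ (j + 1))
    -- the family's support numerics: `M₁ ≥ ((d+4)L + 6)·L²`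
    (hM₁ : (((F.P Kt).d + 4) * (F.P Kt).L + 6) * (F.P Kt).L ^ 2 ≤ ν.M₁)
    -- GEOMETRY instead of the datum letter: the `k`-shadows of the face-crossing members of `𝐁_k(Z)` lie in `𝒞`
    (hGmem : ∀ i ≤ k, ∀ c ∈ lamBondsSeq (maxDomT ν.M₁ Z) k i, blockIter k (embIter i c.tgt) ≠ blockIter k (embIter i c.src) →
      (⟨blockIter k (embIter i c.src), c.dir⟩ : PBond (F.P Kt) k) ∈ 𝒞) :
    ∃ σ : GaugeTransf (F.P Kt) 0 SU2,
      (∀ j, j ≤ k → ∀ b ∈ lamBondsSeq (maxDomT ν.M₁ Z) k j, toMS σ j b.src = 1 ∧ toMS σ j b.tgt = 1) ∧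
        (∀ p : Plaq (F.P Kt) 0, ((⟨p.src, p.μ⟩ : PBond (F.P Kt) 0) ∈ {b : PBond (F.P Kt) 0 | b.src ∈ maxDomT ν.M₁ Z 1} ∨
            (⟨p.src.shift p.μ, p.ν⟩ : PBond (F.P Kt) 0) ∈ {b : PBond (F.P Kt) 0 | b.src ∈ maxDomT ν.M₁ Z 1} ∨
            (⟨p.src.shift p.ν, p.μ⟩ : PBond (F.P Kt) 0) ∈ {b : PBond (F.P Kt) 0 | b.src ∈ maxDomT ν.M₁ Z 1} ∨
            (⟨p.src, p.ν⟩ : PBond (F.P Kt) 0) ∈ {b : PBond (F.P Kt) 0 | b.src ∈ maxDomT ν.M₁ Z 1}) →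
          ‖((gaugeAct σ U₀ ⟨p.src, p.μ⟩ : SU2) : Matrix (Fin 2) (Fin 2) ℂ) - 1‖ ≤
              max ρn ((((2 * (∑ i ∈ Finset.range (k + 1), ((F.P Kt).d * (((F.P Kt).L ^ i - 1) / 2) + 1)) + 1 +
                  (3 * ((F.P Kt).d * (((F.P Kt).L - 1) / 2)) + 5) * (F.P Kt).L ^ k : ℕ) : ℝ)) ^ 2 / 4 * (ν.εreg * (F.P Kt).eta 0 ^ 2) +
                ((3 * ((F.P Kt).d * (((F.P Kt).L - 1) / 2)) + 5 : ℕ) : ℝ) * θ k + ((3 * ((F.P Kt).d * (((F.P Kt).L - 1) / 2)) + 5 : ℕ) : ℝ) * ρn) ∧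
            ‖((gaugeAct σ U₀ ⟨p.src.shift p.μ, p.ν⟩ : SU2) : Matrix (Fin 2) (Fin 2) ℂ) - 1‖ ≤
              max ρn ((((2 * (∑ i ∈ Finset.range (k + 1), ((F.P Kt).d * (((F.P Kt).L ^ i - 1) / 2) + 1)) + 1 +
                  (3 * ((F.P Kt).d * (((F.P Kt).L - 1) / 2)) + 5) * (F.P Kt).L ^ k : ℕ) : ℝ)) ^ 2 / 4 * (ν.εreg * (F.P Kt).eta 0 ^ 2) +
                ((3 * ((F.P Kt).d * (((F.P Kt).L - 1) / 2)) + 5 : ℕ) : ℝ) * θ k + ((3 * ((F.P Kt).d * (((F.P Kt).L - 1) / 2)) + 5 : ℕ) : ℝ) * ρn) ∧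
            ‖((gaugeAct σ U₀ ⟨p.src.shift p.ν, p.μ⟩ : SU2) : Matrix (Fin 2) (Fin 2) ℂ) - 1‖ ≤
              max ρn ((((2 * (∑ i ∈ Finset.range (k + 1), ((F.P Kt).d * (((F.P Kt).L ^ i - 1) / 2) + 1)) + 1 +
                  (3 * ((F.P Kt).d * (((F.P Kt).L - 1) / 2)) + 5) * (F.P Kt).L ^ k : ℕ) : ℝ)) ^ 2 / 4 * (ν.εreg * (F.P Kt).eta 0 ^ 2) +
                ((3 * ((F.P Kt).d * (((F.P Kt).L - 1) / 2)) + 5 : ℕ) : ℝ) * θ k + ((3 * ((F.P Kt).d * (((F.P Kt).L - 1) / 2)) + 5 : ℕ) : ℝ) * ρn) ∧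
            ‖((gaugeAct σ U₀ ⟨p.src, p.ν⟩ : SU2) : Matrix (Fin 2) (Fin 2) ℂ) - 1‖ ≤
              max ρn ((((2 * (∑ i ∈ Finset.range (k + 1), ((F.P Kt).d * (((F.P Kt).L ^ i - 1) / 2) + 1)) + 1 +
                  (3 * ((F.P Kt).d * (((F.P Kt).L - 1) / 2)) + 5) * (F.P Kt).L ^ k : ℕ) : ℝ)) ^ 2 / 4 * (ν.εreg * (F.P Kt).eta 0 ^ 2) +
                ((3 * ((F.P Kt).d * (((F.P Kt).L - 1) / 2)) + 5 : ℕ) : ℝ) * θ k + ((3 * ((F.P Kt).d * (((F.P Kt).L - 1) / 2)) + 5 : ℕ) : ℝ) * ρn)) ∧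
        (∀ b ∈ N,
          ‖((gaugeAct σ U₀ b : SU2) : Matrix (Fin 2) (Fin 2) ℂ) - 1‖ ≤
              max ρn ((((2 * (∑ i ∈ Finset.range (k + 1), ((F.P Kt).d * (((F.P Kt).L ^ i - 1) / 2) + 1)) + 1 +
                  (3 * ((F.P Kt).d * (((F.P Kt).L - 1) / 2)) + 5) * (F.P Kt).L ^ k : ℕ) : ℝ)) ^ 2 / 4 * (ν.εreg * (F.P Kt).eta 0 ^ 2) +
                ((3 * ((F.P Kt).d * (((F.P Kt).L - 1) / 2)) + 5 : ℕ) : ℝ) * θ k + ((3 * ((F.P Kt).d * (((F.P Kt).L - 1) / 2)) + 5 : ℕ) : ℝ) * ρn)) := by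
  obtain ⟨Sfam, h1, h2, h3⟩ := exists_segmentPlaqFamily_Bj ν Kt hk hM₁ hdiv Z
  -- print's members are (b)-members (`Λ_i(Z) ⊆ bondsOf (Γ_i^{(i)})`, `𝐁_k(Z) = genSet (maxDomT M₁ Z) k` by `rfl`): restrict the family's three clauses
  have hsub : ∀ i, lamBondsSeq (maxDomT ν.M₁ Z) k i ⊆ bondsOf ((Bj ν.M₁ Z k : DetSet (F.P Kt)) i) := fun i =>
    lamBondsSeq_subset_bondsOf_genSet (maxDomT ν.M₁ Z) k i
  exact exists_gaugeLetterLoc_atRecord_lamBondsSeq_of_class_of_family ν Kt hk0 hk hM2 hdiv Z hN hRad hρn W 𝒞 hD hmin N hGN hN1 hεpos hα3 hα2 haN θ hθ0 hθ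
    Sfam (fun i hi1 hik c hc => h1 i hi1 hik c (hsub i hc)) (fun i hi1 hik c hc => h2 i hi1 hik c (hsub i hc))
    (fun i hi1 hik c hc => h3 i hi1 hik c (hsub i hc)) hGmem

end Summit.QuantumFields.YangMills.BalabanUVNodes.N12SegmentPlaqFamilyAtRecordLam

end
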